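import Mathlib
import Summits.ValiantsHypothesis.ValiantsHypothesis.Theorems.RestorationQP.Negative.RestorationQPFalseOfArithmeticCFI
import Summits.ValiantsHypothesis.ValiantsHypothesis.Theorems.ProofCarryingSymmetryAssembly
import Summits.ValiantsHypothesis.ValiantsHypothesis.Theorems.HubHub
import Literature.Computability.AlgebraicComplexity.ValiantConjectureProofs

/-!
# Route ProofCarryingSymmetry, crux `RestorationQP` — the arithmetic-CFI dichotomy

Lead c3.  The construction `ArithmeticCFI` (a diagonally `S_n`-invariant VP family over `ℂ` separating
`≡^{C^{εn}}`-equivalent `n`-vertex graphs infinitely often; `Theorems/RestorationQP/Negative/…`, p162481),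
modulo which the crux is refuted (`RestorationQP_false_of_ArithmeticCFI`), EXISTS UNLESS VALIANT'S
HYPOTHESIS HOLDS: if `per ∈ VP` then the permanent family itself is an arithmetic CFI family — it is
diagonally invariant (`rename_smul_perPoly`) and separates the Dawar–Wilsenach perfect-matching CFI pairs
(Thm. 7.2, PROVED: `CFIMatching.DawarWilsenach2025_thm72_family`; in characteristic `0` the permanent of
the adjacency matrix of a bipartite graph is `μ²`, `eval_perPoly_adj_ne_of_card_perfectMatchings_ne`).
Hence the unconditional DICHOTOMY `arithmeticCFI_or_valiantsHypothesis : ArithmeticCFI ∨ ValiantsHypothesis`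
(hub lemma `valiantsHypothesis_of_not_isVPFamily_per`): the refuters' target for this crux and the summit
are complementary — ruling the construction OUT is Valiant's hypothesis; and `RestorationQP → ¬ArithmeticCFI`
(`not_arithmeticCFI_of_restorationQP`) recovers the route's assembly `RestorationQP → ValiantsHypothesis`
through the negative lemma.  Everything proved.
-/

-- single-problem summit: `Summit.ValiantsHypothesis.ValiantsHypothesis.…` is the namespace by design (D-0017)
set_option linter.dupNamespace false

noncomputable section

open scoped Classical

namespace Summit.ValiantsHypothesis.ValiantsHypothesis.Theorems

open Filter
open Literature.Computability.AlgebraicComplexity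
open Literature.ModelTheory.FiniteModelTheory

/-- **If the permanent is in VP, the permanent family is an arithmetic CFI family**: `per_n` is
diagonally `S_n`-invariant, and by Dawar–Wilsenach Thm. 7.2 there are, for every `k`, `≡^{C^k}`-equivalent
bipartite graphs on `m ≤ ck + c` (`> k`) common vertices with different numbers of perfect matchings, hence
(characteristic `0`, `PERM = μ²` on bipartite adjacency matrices) different values of `per_m`; with
`ε = 1/(2c+2)` this is separation with `k ≥ εm` at the infinitely many orders `m = m_k`.
[cite: DawarWilsenach2025, Thm. 7.2 and §7.1 (proof of Thm. 7.1, p. 19)] -/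
theorem arithmeticCFI_of_isVPFamily_per :
    Literature.Computability.AlgebraicComplexity.IsVPFamily
        (fun n => Literature.Computability.AlgebraicComplexity.perPoly (Fin n) ℂ) →
      Summit.ValiantsHypothesis.ValiantsHypothesis.Theorems.ArithmeticCFI := by
  intro hVP
  refine ⟨fun n => perPoly (Fin n) ℂ,
    fun n σ => Summit.ValiantsHypothesis.Theorems.ProofCarryingSymmetry.rename_smul_perPoly n σ, hVP, ?_⟩
  obtain ⟨c, hc⟩ := CFIMatching.DawarWilsenach2025_thm72_family
  choose m hm X Y hXb hYb hXY hpm using hc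
  -- the permanent separates the pairs (characteristic `0`)
  have hne : ∀ k,
      MvPolynomial.eval (fun ij : Fin (m k) × Fin (m k) => if (X k).Adj ij.1 ij.2 then (1 : ℂ) else 0)
          (perPoly (Fin (m k)) ℂ) ≠
        MvPolynomial.eval (fun ij : Fin (m k) × Fin (m k) => if (Y k).Adj ij.1 ij.2 then (1 : ℂ) else 0)
          (perPoly (Fin (m k)) ℂ) := by
    intro k
    obtain ⟨s, t, hs, hst⟩ := hXb k
    obtain ⟨s', t', hs', hst'⟩ := hYb k
    exact eval_perPoly_adj_ne_of_card_perfectMatchings_ne hs hst hs' hst' ℂ (hpm k)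
  -- hence the pairs are not isomorphic, so `k < m k`
  have hkm : ∀ k, k < m k := by
    intro k
    by_contra hk
    have hk' : m k ≤ k := not_lt.mp hk
    apply hpm k
    rcases Nat.eq_zero_or_pos (m k) with h0 | hpos
    · have hXYeq : X k = Y k := by
        ext a b
        exact absurd a.isLt (by omega)
      rw [hXYeq]
    · rcases Nat.eq_zero_or_pos k with hk0 | hkpos
      · omega
      · obtain ⟨e⟩ := (hXY k).nonempty_iso hkpos (by simpa using hk')
        exact Literature.Probability.LatticeModels.card_perfectMatchings_eq_of_iso e
  -- `ε = 1/(2c+2)`: `ε · m k ≤ k` for `k ≥ 1`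
  set ε : ℝ := 1 / (2 * (c : ℝ) + 2) with hε_def
  have hε : 0 < ε := by positivity
  have hεk : ∀ k, 1 ≤ k → ε * ((m k : ℕ) : ℝ) ≤ (k : ℝ) := by
    intro k hk1
    have h1' : ((m k : ℕ) : ℝ) ≤ (c : ℝ) * (k : ℝ) + (c : ℝ) := by exact_mod_cast hm k
    have hk1' : (1 : ℝ) ≤ (k : ℝ) := by exact_mod_cast hk1
    have hc0 : (0 : ℝ) ≤ (c : ℝ) := Nat.cast_nonneg c
    have h2 : ((m k : ℕ) : ℝ) ≤ (2 * (c : ℝ) + 2) * (k : ℝ) := by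
      nlinarith [mul_nonneg hc0 (sub_nonneg.mpr hk1')]
    rw [hε_def, one_div, inv_mul_le_iff₀ (by positivity)]
    exact h2
  refine ⟨ε, hε, Filter.frequently_atTop.2 fun N => ⟨m (N + 1), ?_, N + 1, hεk (N + 1) (by omega),
    X (N + 1), Y (N + 1), hXY (N + 1), hne (N + 1)⟩⟩
  have := hkm (N + 1)
  omega

/-- **THE ARITHMETIC-CFI DICHOTOMY** (unconditional): either an arithmetic CFI family exists — and then
the crux `RestorationQP` is false (`RestorationQP_false_of_ArithmeticCFI`) — or Valiant's hypothesis
`VP_ℂ ≠ VNP_ℂ` holds (if `per ∉ VP`, hub lemma `valiantsHypothesis_of_not_isVPFamily_per` with the bridge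
`mem_VP_ofFintype_iff_holds` and `perFamily_mem_VNP_holds`; if `per ∈ VP`, the permanent is the family).
So the construction item cannot be ruled out short of proving the summit. [folklore] -/
theorem arithmeticCFI_or_valiantsHypothesis :
    Summit.ValiantsHypothesis.ValiantsHypothesis.Theorems.ArithmeticCFI ∨ _root_.ValiantsHypothesis := by
  by_cases h : IsVPFamily (fun n => perPoly (Fin n) ℂ)
  · exact Or.inl (arithmeticCFI_of_isVPFamily_per h)
  · exact Or.inr (Summit.ValiantsHypothesis.Hub.valiantsHypothesis_of_not_isVPFamily_per h
      (mem_VP_ofFintype_iff_holds _) (perFamily_mem_VNP_holds ℂ))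

/-- **`RestorationQP → ¬ ArithmeticCFI`** (contrapositive of the negative lemma): symmetry restoration at
quasi-polynomial cost excludes arithmetic CFI families — with the dichotomy this is the route's assembly
`RestorationQP → ValiantsHypothesis` again, now factored through the construction item. [folklore] -/
theorem not_arithmeticCFI_of_restorationQP
    (hR : Summit.ValiantsHypothesis.ValiantsHypothesis.Theses.ProofCarryingSymmetry.RestorationQP) :
    ¬ ArithmeticCFI :=
  fun h => RestorationQP_false_of_ArithmeticCFI h hR

/-- The assembly recovered: `RestorationQP → ValiantsHypothesis` through the dichotomy. [folklore] -/
theorem valiantsHypothesis_of_restorationQP'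
    (hR : Summit.ValiantsHypothesis.ValiantsHypothesis.Theses.ProofCarryingSymmetry.RestorationQP) :
    _root_.ValiantsHypothesis :=
  (arithmeticCFI_or_valiantsHypothesis.resolve_left (not_arithmeticCFI_of_restorationQP hR))

end Summit.ValiantsHypothesis.ValiantsHypothesis.Theorems

end
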